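import Summits.QuantumFields.BalabanUV.InfraRed.StrongCouplingDoorCeilings
import HarnessLib

/-!
# Instrument cell `ym-instrument`, crew (b), Q-B1 BASELINE: the printed strong-coupling door of the tree in the currency
# «`m(β)·a ≥ c > 0` for every Wilson `0 ≤ β_W ≤ β_cert`» with `c` an EXPLICIT real — `SU(2)`, `d = 4`, `β_cert < 2/7`

QUESTIONS.md row: Q-B1 (REGISTERED 2026-08-26T13:54:11Z; reading A-0826-8), cell `run/shared/lean/pub/ym-instrument/`, HUMAN RULING
D-0084 (2), director-ym R138; currency row T (SC-c) of `ym-instrument-sc-ref/REFEREE.md` §2.  HONEST FRAMING (page 1, binding).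
WHAT IS CERTIFIED HERE AND AT WHICH `(G, D, L, β)`: `G = SU(2)`, `D = 4`, Wilson action, EVERY spatial torus `(ℤ/(2S+1))³` with
`S ≥ S₀(β)` (the statements are uniform in the volume), Wilson coupling `β_W = 4/g² ∈ [0, β_cert]` with `β_cert < 2/7` (tree
coupling `β_W/2`); `m` = the gap of Lüscher's transfer matrix above the
vacuum in LATTICE units (`CrossoverLedger.LatticeMassGap`, i.e. `Sufficient.TransferOperatorGap` on all large tori — the whole
orthocomplement of the vacuum, so in particular the `0⁺⁺` plaquette channel), bounded BELOW by the Dobrushin–Kantorovich–Rubinstein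
rate `krRate (14·β_cert·¼) = −log max(7β_cert/2, 1/2)` of the axial-gauge door.  STRONG-COUPLING SIDE ONLY: nothing at or beyond
`β_W = 2/7`, nothing in the weak-coupling window, NOT a gap at weak coupling, NOT a continuum statement, NOT summit-bearing —
`krRate` is a lower bound produced by the method, not the physical mass.  THE AXIAL-DOOR WINDOW IS CLOSED AT `2/7` BY THEOREM
(the door, not the currency): its hypotheses force `β_W < 2/7` (`StrongCouplingDoorCeilings.su2_axialDoor_ceiling`,
`su2_axialDoor_closed` — restated below as `su2_window_ceiling`), so no row FROM THIS DOOR exists at `β_cert ≥ 2/7`.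
NO NEW ANALYSIS: every theorem below is a one-line specialisation / monotonicity repackaging of the tree's hypothesis-free SC-c door
`StrongCouplingQuarterModulusTwoSevenths.su2_latticeMassGap_axial_lt_twoSevenths` (window `0 ≤ β_W < 2/7`, rate
`krRate (14·β_W·¼)`), stated so that ONE explicit constant serves a whole interval `[0, β_cert]` — the literal shape of Q-B1
«certified `m(β)·a ≥ c > 0` for all `β ≤ β_cert`».  This file is the BASELINE row («the printed door»): it moves no endpoint.

Contents: `latticeMassGap_mono_rate` (a transfer gap `≥ m` is a transfer gap `≥ m'` for `0 < m' ≤ m`), `krRate_anti`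
(the rate is antitone in the Dobrushin constant), `krRate_eq_neg_log`; ★ `su2_latticeMassGap_uniform` (every `β_cert < 2/7`:
ONE rate `krRate (14·β_cert·¼) > 0` on all of `[0, β_cert]`); explicit-rational rows `β_cert = 1/7` (rate `log 2`), `1/4`
(rate `log (8/7)`), `27/100` (rate `log (200/189)`), `7/25` (rate `log (50/49)`), `57/200` (rate `log (400/399)`; the coupling of the
largest SC-c instance filed in the tree, `StrongCouplingDoorCeilings.su2_latticeMassGap_axial_fiftySevenTwoHundredths`); the ceiling
`su2_window_ceiling`.
-/

noncomputable section

open Literature.MathematicalPhysics.QuantumLattice (fundamentalRep)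
open Literature.MathematicalPhysics.QuantumFieldTheory.Balaban1983to89
open Literature.MathematicalPhysics.QuantumFieldTheory.Balaban1983to89.Sufficient (TransferOperatorGap)
open Literature.MathematicalPhysics.QuantumFieldTheory.Balaban1983to89.StrongCouplingTorusWindow (krRate krRate_pos)
open Literature.MathematicalPhysics.QuantumFieldTheory.Balaban1983to89.StrongCouplingDobrushinWindow (OneLinkKRModulusSU2)
open Summit.QuantumFields.BalabanUV.InfraRed.StrongCouplingQuarterModulusTwoSevenths
  (su2_latticeMassGap_axial_lt_twoSevenths)
open Summit.QuantumFields.BalabanUV.InfraRed.StrongCouplingDoorCeilings (su2_axialDoor_ceiling su2_axialDoor_closed)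

namespace Summit.QuantumFields.YangMills.Theorems.Instrument.StrongCouplingMassBaseline

/-! ## 1. Bookkeeping: monotonicity of the transfer gap in the rate, and of the KR rate in the Dobrushin constant -/

section Mono

variable {G : Type} [Group G] [MeasurableSpace G] [TopologicalSpace G] [IsTopologicalGroup G]
  [CompactSpace G] [BorelSpace G] {N : ℕ}

/-- A transfer-operator gap `≥ m` on one spatial torus is a gap `≥ m'` for every `m' ≤ m`
(`e^{−m} ≤ e^{−m'}`). [folklore] -/
theorem transferOperatorGap_mono_rate {ρ : G →* Matrix (Fin N) (Fin N) ℂ} {β m m' : ℝ} {S : ℕ}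
    (h : TransferOperatorGap ρ β S m) (hle : m' ≤ m) : TransferOperatorGap ρ β S m' := by
  obtain ⟨φ, hφ1, hφeig, hgap⟩ := h
  refine ⟨φ, hφ1, hφeig, fun w hw => (hgap w hw).trans ?_⟩
  have hexp : Real.exp (-m) ≤ Real.exp (-m') := Real.exp_le_exp.2 (neg_le_neg hle)
  exact mul_le_mul_of_nonneg_right (mul_le_mul_of_nonneg_right hexp (norm_nonneg _)) (norm_nonneg _)

/-- **A volume-uniform lattice mass gap `≥ m` is a lattice mass gap `≥ m'` for every `0 < m' ≤ m`** (the currency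
`CrossoverLedger.LatticeMassGap` is monotone in its rate). [folklore] -/
theorem latticeMassGap_mono_rate {ρ : G →* Matrix (Fin N) (Fin N) ℂ} {β m m' : ℝ}
    (h : CrossoverLedger.LatticeMassGap ρ β m) (hm' : 0 < m') (hle : m' ≤ m) :
    CrossoverLedger.LatticeMassGap ρ β m' := by
  obtain ⟨_, S₀, hS⟩ := h
  exact ⟨hm', S₀, fun S hS' => transferOperatorGap_mono_rate (hS S hS') hle⟩

end Mono

/-- **The Kantorovich–Rubinstein rate is antitone in the Dobrushin constant**: `c ≤ c' ⟹ krRate c' ≤ krRate c`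
(`krRate c = −log max(c, 1/2)`). [folklore] -/
theorem krRate_anti {c c' : ℝ} (h : c ≤ c') : krRate c' ≤ krRate c := by
  unfold krRate
  have hpos : 0 < max c (1 / 2) := lt_max_of_lt_right (by norm_num)
  exact neg_le_neg (Real.log_le_log hpos (max_le_max h le_rfl))

/-- For a Dobrushin constant `c ≥ 1/2` the rate is literally `−log c`. [folklore] -/
theorem krRate_eq_neg_log {c : ℝ} (h : 1 / 2 ≤ c) : krRate c = -Real.log c := by
  unfold krRate
  rw [max_eq_left h]

/-! ## 2. ★ The uniform row: ONE explicit rate on the whole interval `[0, β_cert]`, every `β_cert < 2/7` -/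

/-- ★ **Q-B1 baseline, `SU(2)`, `d = 4` (the printed SC-c door, uniform form).**  For every `β_cert < 2/7` and every Wilson
coupling `0 ≤ β_W ≤ β_cert`: the volume-uniform transfer-matrix gap `LatticeMassGap (fundamentalRep (Fin 2)) (β_W/2) c` holds
with the SINGLE explicit rate `c = krRate (14·β_cert·¼) = −log max(7β_cert/2, 1/2) > 0` (lattice units).  Proof: the tree's
hypothesis-free door `su2_latticeMassGap_axial_lt_twoSevenths` at `β_W` (rate `krRate (14·β_W·¼)`) and antitonicity of the rate.
Strong-coupling side only; nothing at `β_W ≥ 2/7`; the rate is a lower bound of the method, not the mass. [folklore] -/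
theorem su2_latticeMassGap_uniform {βcert βW : ℝ} (hcert : βcert < 2 / 7) (h0 : 0 ≤ βW) (hle : βW ≤ βcert) :
    CrossoverLedger.LatticeMassGap (fundamentalRep (Fin 2)) (βW / 2) (krRate (14 * βcert * (1 / 4))) :=
  latticeMassGap_mono_rate (su2_latticeMassGap_axial_lt_twoSevenths h0 (lt_of_le_of_lt hle hcert))
    (krRate_pos (by linarith)) (krRate_anti (by linarith))

/-- The uniform rate is positive for every `β_cert < 2/7` (restated for the index). [folklore] -/
theorem krRate_uniform_pos {βcert : ℝ} (hcert : βcert < 2 / 7) : 0 < krRate (14 * βcert * (1 / 4)) :=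
  krRate_pos (by linarith)

/-! ## 3. Rows at explicit rationals (the rate spelled out as the logarithm of a rational) -/

/-- **Row `β_cert = 1/7`** (`g² = 28`): `m·a ≥ log 2 = 0.6931…` for every Wilson `0 ≤ β_W ≤ 1/7`
(Dobrushin constant `7/2 · 1/7 = 1/2`, the floor of `krRate`). [folklore] -/
theorem su2_latticeMassGap_uniform_seventh {βW : ℝ} (h0 : 0 ≤ βW) (hle : βW ≤ 1 / 7) :
    CrossoverLedger.LatticeMassGap (fundamentalRep (Fin 2)) (βW / 2) (Real.log 2) := by
  have h := su2_latticeMassGap_uniform (βcert := 1 / 7) (by norm_num) h0 hle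
  have e : krRate (14 * (1 / 7 : ℝ) * (1 / 4)) = Real.log 2 := by
    rw [krRate_eq_neg_log (by norm_num), show (14 * (1 / 7 : ℝ) * (1 / 4)) = (2 : ℝ)⁻¹ by norm_num, Real.log_inv,
      neg_neg]
  rwa [e] at h

/-- **Row `β_cert = 1/4`** (`g² = 16`): `m·a ≥ log (8/7) = 0.1335…` for every Wilson `0 ≤ β_W ≤ 1/4`
(Dobrushin constant `7/8`). [folklore] -/
theorem su2_latticeMassGap_uniform_quarter {βW : ℝ} (h0 : 0 ≤ βW) (hle : βW ≤ 1 / 4) :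
    CrossoverLedger.LatticeMassGap (fundamentalRep (Fin 2)) (βW / 2) (Real.log (8 / 7)) := by
  have h := su2_latticeMassGap_uniform (βcert := 1 / 4) (by norm_num) h0 hle
  have e : krRate (14 * (1 / 4 : ℝ) * (1 / 4)) = Real.log (8 / 7) := by
    rw [krRate_eq_neg_log (by norm_num), show (14 * (1 / 4 : ℝ) * (1 / 4)) = ((8 : ℝ) / 7)⁻¹ by norm_num,
      Real.log_inv, neg_neg]
  rwa [e] at h

/-- **Row `β_cert = 27/100`** (tree coupling `27/200`): `m·a ≥ log (200/189) = 0.0565…` for every Wilson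
`0 ≤ β_W ≤ 0.27` (Dobrushin constant `189/200`). [folklore] -/
theorem su2_latticeMassGap_uniform_twentySevenHundredths {βW : ℝ} (h0 : 0 ≤ βW) (hle : βW ≤ 27 / 100) :
    CrossoverLedger.LatticeMassGap (fundamentalRep (Fin 2)) (βW / 2) (Real.log (200 / 189)) := by
  have h := su2_latticeMassGap_uniform (βcert := 27 / 100) (by norm_num) h0 hle
  have e : krRate (14 * (27 / 100 : ℝ) * (1 / 4)) = Real.log (200 / 189) := by
    rw [krRate_eq_neg_log (by norm_num), show (14 * (27 / 100 : ℝ) * (1 / 4)) = ((200 : ℝ) / 189)⁻¹ by norm_num,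
      Real.log_inv, neg_neg]
  rwa [e] at h

/-- **Row `β_cert = 7/25 = 0.28`** (`g² = 100/7`; `0.28 < 2/7 = 0.2857…`; the tree files the point instance
`StrongCouplingQuarterModulusTwoSevenths.su2_latticeMassGap_axial_sevenTwentyFifths` here):
`m·a ≥ log (50/49) = 0.0202…` for every Wilson `0 ≤ β_W ≤ 0.28` (Dobrushin constant `49/50`). [folklore] -/
theorem su2_latticeMassGap_uniform_sevenTwentyFifths {βW : ℝ} (h0 : 0 ≤ βW) (hle : βW ≤ 7 / 25) :
    CrossoverLedger.LatticeMassGap (fundamentalRep (Fin 2)) (βW / 2) (Real.log (50 / 49)) := by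
  have h := su2_latticeMassGap_uniform (βcert := 7 / 25) (by norm_num) h0 hle
  have e : krRate (14 * (7 / 25 : ℝ) * (1 / 4)) = Real.log (50 / 49) := by
    rw [krRate_eq_neg_log (by norm_num), show (14 * (7 / 25 : ℝ) * (1 / 4)) = ((50 : ℝ) / 49)⁻¹ by norm_num,
      Real.log_inv, neg_neg]
  rwa [e] at h

/-- **Row `β_cert = 57/200 = 0.285`** (tree coupling `57/400`; the coupling of the LARGEST SC-c point instance filed in the tree,
`StrongCouplingDoorCeilings.su2_latticeMassGap_axial_fiftySevenTwoHundredths`; `0.285 < 2/7`): `m·a ≥ log (400/399) = 0.002503…`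
for every Wilson `0 ≤ β_W ≤ 0.285` (Dobrushin constant `399/400`). [folklore] -/
theorem su2_latticeMassGap_uniform_fiftySevenTwoHundredths {βW : ℝ} (h0 : 0 ≤ βW) (hle : βW ≤ 57 / 200) :
    CrossoverLedger.LatticeMassGap (fundamentalRep (Fin 2)) (βW / 2) (Real.log (400 / 399)) := by
  have h := su2_latticeMassGap_uniform (βcert := 57 / 200) (by norm_num) h0 hle
  have e : krRate (14 * (57 / 200 : ℝ) * (1 / 4)) = Real.log (400 / 399) := by
    rw [krRate_eq_neg_log (by norm_num), show (14 * (57 / 200 : ℝ) * (1 / 4)) = ((400 : ℝ) / 399)⁻¹ by norm_num,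
      Real.log_inv, neg_neg]
  rwa [e] at h

/-- The five explicit rates are positive reals: `0 < log (400/399) < log (50/49) < log (200/189) < log (8/7) < log 2`
(each row is a genuine `c > 0`; the rate degrades to `0` as `β_cert ↑ 2/7`). [folklore] -/
theorem rows_rate_pos_chain :
    0 < Real.log (400 / 399) ∧ Real.log (400 / 399) < Real.log (50 / 49) ∧ Real.log (50 / 49) < Real.log (200 / 189) ∧
      Real.log (200 / 189) < Real.log (8 / 7) ∧ Real.log (8 / 7) < Real.log 2 := by
  refine ⟨Real.log_pos (by norm_num), Real.log_lt_log (by norm_num) (by norm_num),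
    Real.log_lt_log (by norm_num) (by norm_num), Real.log_lt_log (by norm_num) (by norm_num),
    Real.log_lt_log (by norm_num) (by norm_num)⟩

/-! ## 4. The window is closed at `2/7` (the door ceiling, by name) -/

/-- **No row of this shape exists at `β_cert ≥ 2/7`** (the axial door's ceiling, tree `StrongCouplingDoorCeilings`): at a positive
Wilson coupling the door's two hypotheses — an admissible one-link Kantorovich–Rubinstein modulus `K₂` (`OneLinkKRModulusSU2 β_W K₂`)
and the smallness `14·β_W·K₂ < 1` — force `β_W < 2/7`; and at every `β_W ≥ 2/7` the smallness fails (`1 ≤ 14·β_W·K₂`) for EVERY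
admissible `K₂`.  «`2/7` is where `14·β_W·K₂ = 1` at the floor `K₂ = 1/4`» is thus a theorem, not prose; pushing `β_cert` past `2/7`
in this currency needs a different door. [folklore] -/
theorem su2_window_ceiling {βW K₂ : ℝ} (hmod : OneLinkKRModulusSU2 βW K₂) :
    (0 < βW → 14 * βW * K₂ < 1 → βW < 2 / 7) ∧ (2 / 7 ≤ βW → 1 ≤ 14 * βW * K₂) :=
  ⟨fun hβ hwin => su2_axialDoor_ceiling hβ hmod hwin, fun hβ => su2_axialDoor_closed hβ hmod⟩

end Summit.QuantumFields.YangMills.Theorems.Instrument.StrongCouplingMassBaseline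

end
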